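import Summits.CriticalPhenomena.SAWScalingLimit.Theorems.SAWLoopFugacityFlowIsingBoundaryRatioWindowResistanceDefs
import Summits.CriticalPhenomena.SAWScalingLimit.Theorems.SAWLoopFugacityFlowIsingBoundaryRatioSideCrossSeparation
import Literature.Probability.LatticeModels.DiscreteExtremalLengthExternalArcsProofs
import HarnessLib

/-!
# Resistance bound for the window rectangle — cell and corner bookkeeping
(line `fk-anchor-transfer`, crux `IsingBoundaryRatio`, stmt-CriticalPhenomena-10650; first helper module of the
proof of `WindowExtResistanceBound`, `…IsingBoundaryRatioWindowResistanceDefs.lean`)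

Elementary lattice bookkeeping for the face-chain extraction along chart semicircles (Chelkak 2016,
Prop. 6.2 (i), the elementary direction): cells `Mesh.cell δ k j` of `δℤ²`, their corners
`Mesh.corner k j a b` (`a b : Bool`), and walks of the graph `⟨E⟩ = fromEdgeSet E` of a finite edge set
`E` along the sides of cells:

* `wer_cell_walk` — inside a cell whose four sides are in `E`, any two corners are joined by a walk of `⟨E⟩`
  through corners of the cell;
* `wer_walkaround` — walking around a cell from a corner that is a vertex of `E`, when every side at a
  vertex of `E` is either in `E` or witnesses a boundary vertex (`DiscreteRect.bdVerts`): either the cell is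
  full (four corners in `verts E`, four sides in `E`) or a boundary vertex of `E` is reached within the cell;
* `wer_chain_walk` — along a chain of full cells, consecutive ones at sup-distance `≤ 1` (they share a
  corner, `wer_common_corner`), the first corner is joined to every corner of the last cell;
* metric facts: the closed cell containing a point (`wer_mem_closure_cell_floor`), two closed cells with a
  common point are at sup-distance `≤ 1` (`wer_near_of_mem_closure_cell`), corners are within `2δ` of the
  points of the closed cell (`wer_dist_corner_le`), lattice steps `x ↦ x + e_k` (`wer_adj_add_dir`,
  `wer_dist_add_dir`), vertices of `E ⊆ E(Ω_δ)` are sites of `Ω_δ` (`wer_verts_subset`).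

All statements are folklore.
-/

noncomputable section

open scoped Classical Topology
open Filter Set Metric SimpleGraph
open Literature.Probability.LatticeModels Literature.Probability.RandomPlanarGeometry
open Literature.Probability.Percolation (BondConfig)
open UpperHalfPlane (upperHalfPlaneSet)

namespace Summit.CriticalPhenomena.SAWScalingLimit.Theorems.IsingBoundaryRatio

/-! ### Corners of a cell -/

/-- Horizontally adjacent corners are lattice neighbours. [folklore] -/
theorem wer_adj_corner_fst (k j : ℤ) (a b : Bool) :
    (zdGraph 2).Adj (Mesh.corner k j a b) (Mesh.corner k j (!a) b) := by
  cases a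
  · exact Mesh.zdGraph_adj_corner_horizontal k j b
  · exact (Mesh.zdGraph_adj_corner_horizontal k j b).symm

/-- Vertically adjacent corners are lattice neighbours. [folklore] -/
theorem wer_adj_corner_snd (k j : ℤ) (a b : Bool) :
    (zdGraph 2).Adj (Mesh.corner k j a b) (Mesh.corner k j a (!b)) := by
  cases b
  · exact Mesh.zdGraph_adj_corner_vertical k j a
  · exact (Mesh.zdGraph_adj_corner_vertical k j a).symm

/-- The horizontal neighbour of a corner is a lattice step away. [folklore] -/
theorem wer_corner_not_fst (k j : ℤ) (a b : Bool) :
    Mesh.corner k j (!a) b = Mesh.corner k j a b + DiscreteRect.dir (if a then 2 else 0) := by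
  cases a <;> (funext l; fin_cases l <;> simp [Mesh.corner, DiscreteRect.dir])

/-- The vertical neighbour of a corner is a lattice step away. [folklore] -/
theorem wer_corner_not_snd (k j : ℤ) (a b : Bool) :
    Mesh.corner k j a (!b) = Mesh.corner k j a b + DiscreteRect.dir (if b then 3 else 1) := by
  cases b <;> (funext l; fin_cases l <;> simp [Mesh.corner, DiscreteRect.dir])

/-- Two cells at sup-distance `≤ 1` share a corner. [folklore] -/
theorem wer_common_corner {k j k' j' : ℤ} (hk : |k - k'| ≤ 1) (hj : |j - j'| ≤ 1) :
    Mesh.corner k j (decide (k < k')) (decide (j < j')) =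
      Mesh.corner k' j' (decide (k' < k)) (decide (j' < j)) := by
  rw [abs_le] at hk hj
  funext l
  fin_cases l <;> simp [Mesh.corner] <;> split_ifs <;> omega

/-! ### Walks along the sides of cells -/

/-- **Inside a cell whose four sides are in `E`, any two corners are joined** by a walk of `⟨E⟩`
through corners of the cell. [folklore] -/
theorem wer_cell_walk {E : Finset (Sym2 (Site 2))} {k j : ℤ}
    (h1 : ∀ b, s(Mesh.corner k j false b, Mesh.corner k j true b) ∈ E)
    (h2 : ∀ a, s(Mesh.corner k j a false, Mesh.corner k j a true) ∈ E) (a b a' b' : Bool) :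
    ∃ p : (fromEdgeSet (↑E : Set (Sym2 (Site 2)))).Walk (Mesh.corner k j a b) (Mesh.corner k j a' b'),
      ∀ x ∈ p.support, ∃ a'' b'', x = Mesh.corner k j a'' b'' := by
  set G := fromEdgeSet (↑E : Set (Sym2 (Site 2))) with hG
  have hH : ∀ a b, G.Adj (Mesh.corner k j a b) (Mesh.corner k j (!a) b) := by
    intro a b
    refine (fromEdgeSet_adj _).2 ⟨?_, (wer_adj_corner_fst k j a b).ne⟩
    cases a
    · exact h1 b
    · rw [Finset.mem_coe, Sym2.eq_swap]; exact h1 b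
  have hV : ∀ a b, G.Adj (Mesh.corner k j a b) (Mesh.corner k j a (!b)) := by
    intro a b
    refine (fromEdgeSet_adj _).2 ⟨?_, (wer_adj_corner_snd k j a b).ne⟩
    cases b
    · exact h2 a
    · rw [Finset.mem_coe, Sym2.eq_swap]; exact h2 a
  have step1 : ∃ p : G.Walk (Mesh.corner k j a b) (Mesh.corner k j a' b),
      ∀ x ∈ p.support, ∃ a'' b'', x = Mesh.corner k j a'' b'' := by
    by_cases haa : a = a'
    · subst haa
      exact ⟨Walk.nil, fun x hx => ⟨a, b, by simpa using hx⟩⟩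
    · have : a' = !a := by cases a <;> cases a' <;> simp_all
      subst this
      refine ⟨Walk.cons (hH a b) Walk.nil, fun x hx => ?_⟩
      simp only [Walk.support_cons, Walk.support_nil, List.mem_cons, List.not_mem_nil, or_false] at hx
      rcases hx with rfl | rfl
      · exact ⟨a, b, rfl⟩
      · exact ⟨!a, b, rfl⟩
  have step2 : ∃ p : G.Walk (Mesh.corner k j a' b) (Mesh.corner k j a' b'),
      ∀ x ∈ p.support, ∃ a'' b'', x = Mesh.corner k j a'' b'' := by
    by_cases hbb : b = b'
    · subst hbb
      exact ⟨Walk.nil, fun x hx => ⟨a', b, by simpa using hx⟩⟩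
    · have : b' = !b := by cases b <;> cases b' <;> simp_all
      subst this
      refine ⟨Walk.cons (hV a' b) Walk.nil, fun x hx => ?_⟩
      simp only [Walk.support_cons, Walk.support_nil, List.mem_cons, List.not_mem_nil, or_false] at hx
      rcases hx with rfl | rfl
      · exact ⟨a', b, rfl⟩
      · exact ⟨a', !b, rfl⟩
  obtain ⟨p1, hp1⟩ := step1
  obtain ⟨p2, hp2⟩ := step2
  refine ⟨p1.append p2, fun x hx => ?_⟩
  rw [Walk.mem_support_append_iff] at hx
  rcases hx with hx | hx
  · exact hp1 x hx
  · exact hp2 x hx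

/-- **Walk-around lemma.** Let a corner of the cell `(k, j)` be a vertex of `E`, and suppose that at
every corner that is a vertex of `E` each of the two sides of the cell is in `E` unless that corner is a
boundary vertex of `E`. Then either the cell is full (four corners in `verts E`, four sides in `E`), or a
corner that is a boundary vertex of `E` is joined to the given corner by a walk of `⟨E⟩` through corners
of the cell. [folklore] -/
theorem wer_walkaround {E : Finset (Sym2 (Site 2))} {k j : ℤ} {a₀ b₀ : Bool}
    (hv : Mesh.corner k j a₀ b₀ ∈ DiscreteRect.verts E)
    (HC1 : ∀ a b, Mesh.corner k j a b ∈ DiscreteRect.verts E →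
      s(Mesh.corner k j a b, Mesh.corner k j (!a) b) ∈ E ∨ Mesh.corner k j a b ∈ DiscreteRect.bdVerts E)
    (HC2 : ∀ a b, Mesh.corner k j a b ∈ DiscreteRect.verts E →
      s(Mesh.corner k j a b, Mesh.corner k j a (!b)) ∈ E ∨ Mesh.corner k j a b ∈ DiscreteRect.bdVerts E) :
    ((∀ a b, Mesh.corner k j a b ∈ DiscreteRect.verts E) ∧
      (∀ b, s(Mesh.corner k j false b, Mesh.corner k j true b) ∈ E) ∧
      (∀ a, s(Mesh.corner k j a false, Mesh.corner k j a true) ∈ E)) ∨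
    ∃ a b, Mesh.corner k j a b ∈ DiscreteRect.verts E ∧ Mesh.corner k j a b ∈ DiscreteRect.bdVerts E ∧
      ∃ p : (fromEdgeSet (↑E : Set (Sym2 (Site 2)))).Walk (Mesh.corner k j a₀ b₀) (Mesh.corner k j a b),
        ∀ x ∈ p.support, ∃ a'' b'', x = Mesh.corner k j a'' b'' := by
  set G := fromEdgeSet (↑E : Set (Sym2 (Site 2))) with hG
  have nilP : ∀ a b, ∃ p : G.Walk (Mesh.corner k j a b) (Mesh.corner k j a b),
      ∀ x ∈ p.support, ∃ a'' b'', x = Mesh.corner k j a'' b'' :=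
    fun a b => ⟨Walk.nil, fun x hx => ⟨a, b, by simpa using hx⟩⟩
  have consP : ∀ {a b a' b' : Bool} {y : Site 2}, G.Adj (Mesh.corner k j a b) (Mesh.corner k j a' b') →
      y = Mesh.corner k j a' b' →
      ∃ p : G.Walk (Mesh.corner k j a b) y, ∀ x ∈ p.support, ∃ a'' b'', x = Mesh.corner k j a'' b'' := by
    intro a b a' b' y h hy
    subst hy
    refine ⟨Walk.cons h Walk.nil, fun x hx => ?_⟩
    simp only [Walk.support_cons, Walk.support_nil, List.mem_cons, List.not_mem_nil, or_false] at hx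
    rcases hx with rfl | rfl
    · exact ⟨a, b, rfl⟩
    · exact ⟨a', b', rfl⟩
  by_cases hbd0 : Mesh.corner k j a₀ b₀ ∈ DiscreteRect.bdVerts E
  · exact Or.inr ⟨a₀, b₀, hv, hbd0, nilP a₀ b₀⟩
  have e1 : s(Mesh.corner k j a₀ b₀, Mesh.corner k j (!a₀) b₀) ∈ E := (HC1 a₀ b₀ hv).resolve_right hbd0
  have e2 : s(Mesh.corner k j a₀ b₀, Mesh.corner k j a₀ (!b₀)) ∈ E := (HC2 a₀ b₀ hv).resolve_right hbd0
  have hv1 : Mesh.corner k j (!a₀) b₀ ∈ DiscreteRect.verts E := DiscreteRect.mem_verts_of_mem e1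
  have hv2 : Mesh.corner k j a₀ (!b₀) ∈ DiscreteRect.verts E := DiscreteRect.mem_verts_of_mem e2
  have adj1 : G.Adj (Mesh.corner k j a₀ b₀) (Mesh.corner k j (!a₀) b₀) :=
    (fromEdgeSet_adj _).2 ⟨e1, (wer_adj_corner_fst k j a₀ b₀).ne⟩
  have adj2 : G.Adj (Mesh.corner k j a₀ b₀) (Mesh.corner k j a₀ (!b₀)) :=
    (fromEdgeSet_adj _).2 ⟨e2, (wer_adj_corner_snd k j a₀ b₀).ne⟩
  by_cases hbd1 : Mesh.corner k j (!a₀) b₀ ∈ DiscreteRect.bdVerts E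
  · exact Or.inr ⟨!a₀, b₀, hv1, hbd1, consP adj1 rfl⟩
  by_cases hbd2 : Mesh.corner k j a₀ (!b₀) ∈ DiscreteRect.bdVerts E
  · exact Or.inr ⟨a₀, !b₀, hv2, hbd2, consP adj2 rfl⟩
  have e3 : s(Mesh.corner k j (!a₀) b₀, Mesh.corner k j (!a₀) (!b₀)) ∈ E :=
    (HC2 (!a₀) b₀ hv1).resolve_right hbd1
  have e4 : s(Mesh.corner k j a₀ (!b₀), Mesh.corner k j (!a₀) (!b₀)) ∈ E :=
    (HC1 a₀ (!b₀) hv2).resolve_right hbd2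
  have hv3 : Mesh.corner k j (!a₀) (!b₀) ∈ DiscreteRect.verts E := DiscreteRect.mem_verts_of_mem e3
  refine Or.inl ⟨?_, ?_, ?_⟩
  · intro a b
    rcases Bool.eq_or_eq_not a a₀ with rfl | rfl <;> rcases Bool.eq_or_eq_not b b₀ with rfl | rfl
    · exact hv
    · exact hv2
    · exact hv1
    · exact hv3
  · intro b
    rcases Bool.eq_or_eq_not b b₀ with rfl | rfl
    · cases a₀
      · exact e1
      · rw [Sym2.eq_swap]; exact e1
    · cases a₀
      · exact e4
      · rw [Sym2.eq_swap]; simpa using e4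
  · intro a
    rcases Bool.eq_or_eq_not a a₀ with rfl | rfl
    · cases b₀
      · exact e2
      · rw [Sym2.eq_swap]; exact e2
    · cases b₀
      · exact e3
      · rw [Sym2.eq_swap]; simpa using e3

/-- **Chain lemma.** Along a chain `q₀ → … → q` of cells with four sides in `E`, consecutive cells at
sup-distance `≤ 1`, the lower-left corner of `q₀` is joined in `⟨E⟩` to every corner of `q`, through
vertices satisfying any property `P` that holds at all corners of the cells of the chain. [folklore] -/
theorem wer_chain_walk {E : Finset (Sym2 (Site 2))} {R : ℤ × ℤ → ℤ × ℤ → Prop} {P : Site 2 → Prop}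
    (hR : ∀ A B, R A B →
      ((∀ b, s(Mesh.corner B.1 B.2 false b, Mesh.corner B.1 B.2 true b) ∈ E) ∧
        (∀ a, s(Mesh.corner B.1 B.2 a false, Mesh.corner B.1 B.2 a true) ∈ E)) ∧
      |A.1 - B.1| ≤ 1 ∧ |A.2 - B.2| ≤ 1 ∧ ∀ a b, P (Mesh.corner B.1 B.2 a b))
    {q₀ q : ℤ × ℤ}
    (h0 : ((∀ b, s(Mesh.corner q₀.1 q₀.2 false b, Mesh.corner q₀.1 q₀.2 true b) ∈ E) ∧
        (∀ a, s(Mesh.corner q₀.1 q₀.2 a false, Mesh.corner q₀.1 q₀.2 a true) ∈ E)) ∧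
      ∀ a b, P (Mesh.corner q₀.1 q₀.2 a b))
    (hq : Relation.ReflTransGen R q₀ q) (a b : Bool) :
    ∃ p : (fromEdgeSet (↑E : Set (Sym2 (Site 2)))).Walk (Mesh.corner q₀.1 q₀.2 false false)
      (Mesh.corner q.1 q.2 a b), ∀ x ∈ p.support, P x := by
  revert a b
  induction hq with
  | refl =>
    intro a b
    obtain ⟨p, hp⟩ := wer_cell_walk h0.1.1 h0.1.2 false false a b
    refine ⟨p, fun x hx => ?_⟩
    obtain ⟨a'', b'', rfl⟩ := hp x hx
    exact h0.2 a'' b''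
  | @tail A B _ hAB ih =>
    intro a b
    obtain ⟨hsides, hk, hj, hP⟩ := hR A B hAB
    have hcc := wer_common_corner hk hj
    obtain ⟨p1, hp1⟩ := ih (decide (A.1 < B.1)) (decide (A.2 < B.2))
    obtain ⟨p2, hp2⟩ := wer_cell_walk hsides.1 hsides.2 (decide (B.1 < A.1)) (decide (B.2 < A.2)) a b
    refine ⟨(p1.copy rfl hcc).append p2, fun x hx => ?_⟩
    rw [Walk.mem_support_append_iff, Walk.support_copy] at hx
    rcases hx with hx | hx
    · exact hp1 x hx
    · obtain ⟨a'', b'', rfl⟩ := hp2 x hx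
      exact hP a'' b''

/-! ### Metric bookkeeping -/

/-- Every point lies in the closed cell named by the integer parts of its coordinates. [folklore] -/
theorem wer_mem_closure_cell_floor {δ : ℝ} (hδ : 0 < δ) (z : ℂ) :
    z ∈ closure (Mesh.cell δ ⌊z.re / δ⌋ ⌊z.im / δ⌋) := by
  rw [Mesh.closure_cell hδ, Complex.mem_reProdIm]
  constructor
  · constructor
    · have := Int.floor_le (z.re / δ)
      rw [le_div_iff₀ hδ] at this; linarith
    · have := Int.lt_floor_add_one (z.re / δ)
      rw [div_lt_iff₀ hδ] at this; linarith
  · constructor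
    · have := Int.floor_le (z.im / δ)
      rw [le_div_iff₀ hδ] at this; linarith
    · have := Int.lt_floor_add_one (z.im / δ)
      rw [div_lt_iff₀ hδ] at this; linarith

/-- Two closed cells with a common point are at sup-distance `≤ 1`. [folklore] -/
theorem wer_near_of_mem_closure_cell {δ : ℝ} (hδ : 0 < δ) {k j k' j' : ℤ} {z : ℂ}
    (hz : z ∈ closure (Mesh.cell δ k j)) (hz' : z ∈ closure (Mesh.cell δ k' j')) :
    |k - k'| ≤ 1 ∧ |j - j'| ≤ 1 := by
  rw [Mesh.closure_cell hδ, Complex.mem_reProdIm] at hz hz'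
  obtain ⟨⟨h1, h2⟩, h3, h4⟩ := hz
  obtain ⟨⟨h1', h2'⟩, h3', h4'⟩ := hz'
  have a1 : (k : ℝ) ≤ k' + 1 := le_of_mul_le_mul_left (h1.trans h2') hδ
  have a2 : (k' : ℝ) ≤ k + 1 := le_of_mul_le_mul_left (h1'.trans h2) hδ
  have a3 : (j : ℝ) ≤ j' + 1 := le_of_mul_le_mul_left (h3.trans h4') hδ
  have a4 : (j' : ℝ) ≤ j + 1 := le_of_mul_le_mul_left (h3'.trans h4) hδ
  have b1 : k ≤ k' + 1 := by exact_mod_cast a1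
  have b2 : k' ≤ k + 1 := by exact_mod_cast a2
  have b3 : j ≤ j' + 1 := by exact_mod_cast a3
  have b4 : j' ≤ j + 1 := by exact_mod_cast a4
  rw [abs_le, abs_le]; omega

/-- The corners of a cell are within `2δ` of every point of the closed cell. [folklore] -/
theorem wer_dist_corner_le {δ : ℝ} (hδ : 0 < δ) {k j : ℤ} {z : ℂ} (hz : z ∈ closure (Mesh.cell δ k j))
    (a b : Bool) : dist (meshPoint δ (Mesh.corner k j a b)) z ≤ 2 * δ := by
  rw [Mesh.closure_cell hδ, Complex.mem_reProdIm] at hz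
  obtain ⟨⟨h1, h2⟩, h3, h4⟩ := hz
  have ha := Mesh.ite_cast_mem_unit a
  have hb := Mesh.ite_cast_mem_unit b
  rw [Complex.dist_eq]
  refine (Complex.norm_le_abs_re_add_abs_im _).trans ?_
  rw [Complex.sub_re, Complex.sub_im, meshPoint_re, meshPoint_im, Mesh.corner_zero, Mesh.corner_one]
  push_cast
  have hre : |δ * (↑k + ((if a = true then 1 else 0 : ℤ) : ℝ)) - z.re| ≤ δ := by
    rw [abs_le]; constructor <;> nlinarith
  have him : |δ * (↑j + ((if b = true then 1 else 0 : ℤ) : ℝ)) - z.im| ≤ δ := by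
    rw [abs_le]; constructor <;> nlinarith
  push_cast at hre him
  linarith

/-- The four lattice steps `x ↦ x + e_k` are adjacencies of `ℤ²`. [folklore] -/
theorem wer_adj_add_dir (x : Site 2) (k : Fin 4) : (zdGraph 2).Adj x (x + DiscreteRect.dir k) := by
  rw [zdGraph_adj_iff]
  fin_cases k
  · exact ⟨0, Or.inl rfl⟩
  · exact ⟨1, Or.inl rfl⟩
  · exact ⟨0, Or.inr (by simp [DiscreteRect.dir])⟩
  · exact ⟨1, Or.inr (by simp [DiscreteRect.dir])⟩

/-- A lattice step has length `δ`. [folklore] -/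
theorem wer_dist_add_dir {δ : ℝ} (hδ : 0 < δ) (x : Site 2) (k : Fin 4) :
    dist (meshPoint δ (x + DiscreteRect.dir k)) (meshPoint δ x) = δ := by
  rw [_root_.dist_comm, Literature.Probability.Percolation.dist_meshPoint_of_adj (wer_adj_add_dir x k),
    abs_of_pos hδ]

/-- Vertices of `E ⊆ E(Ω_δ)` are sites of `Ω_δ`. [folklore] -/
theorem wer_verts_subset {Ω : Set ℂ} {δ : ℝ} {E : Finset (Sym2 (Site 2))}
    (hE : ∀ e ∈ E, e ∈ (discreteDomainGraph Ω δ).edgeSet) {x : Site 2} (hx : x ∈ DiscreteRect.verts E) :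
    x ∈ meshDomain Ω δ := by
  unfold DiscreteRect.verts at hx
  obtain ⟨e, he, hxe⟩ := Finset.mem_biUnion.1 hx
  revert he hxe
  induction e using Sym2.ind with
  | h a b =>
    intro he hxe
    have hadj : (discreteDomainGraph Ω δ).Adj a b := hE _ he
    obtain ⟨-, ha, hb⟩ := discreteDomainGraph_adj_iff.1 hadj
    simp only [DiscreteRect.endpts, Sym2.lift_mk, Finset.mem_insert, Finset.mem_singleton] at hxe
    rcases hxe with rfl | rfl
    · exact ha
    · exact hb

/-- Vertices of `E ⊆ E(Ω_δ)` are sites of `Ω_δ`, closed form (registered sub-goal of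
stmt-CriticalPhenomena-10650). [folklore] -/
theorem wer_verts_subset' : ∀ {Ω : Set ℂ} {δ : ℝ} {E : Finset (Sym2 (Site 2))}, (∀ e ∈ E, e ∈ (discreteDomainGraph Ω δ).edgeSet) → ∀ {x : Site 2}, x ∈ DiscreteRect.verts E → x ∈ meshDomain Ω δ :=
  fun hE _ hx => wer_verts_subset hE hx

end Summit.CriticalPhenomena.SAWScalingLimit.Theorems.IsingBoundaryRatio

end
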